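import Mathlib
import Summits.Schanuel.Schanuel.Theses.AdelicLogSector
import Summits.Schanuel.Schanuel.Theorems.RigidCoreSchanuelOnLogFreeCoreSectorGlue
import Literature.FieldTheory.TranscendenceDegree.AlgebraicDependenceBookkeeping

/-!
# Birth skeleton (BC3) for crux `OffPrimeLogSector` (stmt-Schanuel-7090, route `AdelicLogSector`)

The crux is Schanuel's conjecture RELATIVE to the prime-log field
`K₁ = ℚ(log p : p prime)` for tuples `x ∈ ℂⁿ` that are `ℚ`-free modulo
`V₁ = span_ℚ {log p : p prime}`:  `n ≤ trdeg_{K₁} K₁(x, eˣ)`.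

This file registers the SECOND SECTOR SPLIT of that statement, along the classical sector
`E = span_ℚ({log p} ∪ ℚ̄ ∪ {πi}) ⊇ V₁` over the prime-log–π–Lindemann–Weierstrass field
`L₁ = ℚ({log p} ∪ ℚ̄ ∪ {πi} ∪ e^{ℚ̄}) ⊇ K₁` — the `K₁`-relative analogue of the landed split
`PiFreeOverLWField ∧ RelSchanuelOverPiLWField ⟹ Schanuel`
(`Theorems/RigidCoreSchanuelOnLogFreeCoreSectorGlue.lean`, `SectorGlue.engine`; J. Kirby,
*Exponential algebraicity in exponential fields*, Bull. LMS 42 (2010) §3; M. Waldschmidt,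
*Diophantine approximation on linear algebraic groups* (2000) §1.4):

* `stub_piLWFreeOverPrimeLogField` (INSIDE count, the classical constants): for `ℚ`-linearly
  independent algebraic `a₁ … a_d`, `d + 1 ≤ trdeg_{K₁} K₁(π, e^{a₁}, …, e^{a_d})` — π-free
  Lindemann–Weierstrass OVER THE PRIME-LOG FIELD (`PiFreeOverLWField` with base `ℚ` replaced by
  `ℚ(log 2, log 3, log 5, …)`; already `d = 0`: `π ∉ ℚ(log p : p prime)^{alg}` is open);
* `stub_relSchanuelOverPrimeLogPiLWField` (OUTSIDE count, the generic core): Schanuel relative to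
  `L₁` for tuples `ℚ`-free modulo `E` (`RelSchanuelOverPiLWField` with the prime logarithms
  also quotiented out).

The composition `offPrimeLogSector_of_pieces : stub₁-sig → stub₂-sig → ⟨OffPrimeLogSector, unfolded⟩`
is PROVED (no `sorry`; Kirby's `GL_n(ℚ)` base change run over the bottom field `K₁`) and
`OffPrimeLogSector_of : OffPrimeLogSector` applies it to the two stubs BY NAME: for `x` free modulo
`V₁` let `V = span_ℚ(x)`, `W = V ⊓ E` with basis `y` (`k` vectors), `U` a complement of `W` in `V`
with basis `z` (`m` vectors, free modulo `E`), `k + m = n`; write `yᵢ = vᵢ + eᵢ` (`vᵢ ∈ V₁`,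
`eᵢ ∈ span_ℚ(ℚ̄ ∪ {πi})`, `e` `ℚ`-free because `y` is free modulo `V₁`); then
`k ≤ trdeg_{K₁} K₁(e, eᵉ) ≤ trdeg_{K₁} K₁(y, eʸ)` (inside count at `e`, `eʸ = eᵛ·eᵉ` with `eᵛ`
algebraic), `m ≤ trdeg_{L₁} L₁(z, eᶻ) ≤ trdeg_{K₁(y,eʸ)} K₁(y, eʸ)(z, eᶻ)` (outside count, base
change DOWN `L₁ ↝ K₁(y, eʸ)`), and the tower law plus `K₁(y, eʸ, z, eᶻ) ⊆ K₁(x, eˣ)^{alg}` give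
`n ≤ trdeg_{K₁} K₁(x, eˣ)`.  The only sorries of the file are the two stubs.
-/

set_option linter.dupNamespace false

namespace Summit.Schanuel.Schanuel.Cruxes.OffPrimeLogSector.Birth

open Summit.Schanuel.Schanuel.Theses.AdelicLogSector
open IntermediateField Complex Submodule Set Function Literature.FieldTheory.TranscendenceDegree
open Algebra (trdeg)
open Summit.Schanuel.Schanuel.Theorems.RigidCore.SectorGlue

/-! ## The two registered stubs -/

/-- **STUB 1 (inside count): π-free Lindemann–Weierstrass over the prime-log field.**
For `ℚ`-linearly independent algebraic numbers `a₁, …, a_d`,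
`d + 1 ≤ trdeg_{K₁} K₁(π, e^{a₁}, …, e^{a_d})` with `K₁ = ℚ(log p : p prime)`:
`π, e^{a₁}, …, e^{a_d}` are algebraically independent over the field generated by the real
logarithms of the primes (`GaussianStokesSector.PiFreeOverLWField` relative to `K₁`; a
consequence of Schanuel's conjecture; open already for `d = 0`). -/
theorem stub_piLWFreeOverPrimeLogField :
    ∀ (d : ℕ) (a : Fin d → ℂ), (∀ i, IsAlgebraic ℚ (a i)) → LinearIndependent ℚ a →
      ((d + 1 : ℕ) : Cardinal) ≤ Algebra.trdeg
        ↥(IntermediateField.adjoin ℚ {z : ℂ | ∃ p : ℕ, p.Prime ∧ z = ((Real.log (p : ℝ) : ℝ) : ℂ)})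
        ↥(IntermediateField.adjoin
            ↥(IntermediateField.adjoin ℚ {z : ℂ | ∃ p : ℕ, p.Prime ∧ z = ((Real.log (p : ℝ) : ℝ) : ℂ)})
            (insert (Real.pi : ℂ) (Set.range (Complex.exp ∘ a)))) := by
  sorry

/-- **STUB 2 (outside count): relative Schanuel over the prime-log–π–LW field.**
If `x₁, …, xₙ ∈ ℂ` are `ℚ`-linearly independent modulo
`E = span_ℚ({log p : p prime} ∪ ℚ̄ ∪ {πi})`, then
`n ≤ trdeg_{L₁} L₁(x, eˣ)` for `L₁ = ℚ({log p} ∪ ℚ̄ ∪ {πi} ∪ e^{ℚ̄})`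
(`GaussianStokesSector.RelSchanuelOverPiLWField` with the prime logarithms also quotiented out;
a consequence of Schanuel's conjecture). -/
theorem stub_relSchanuelOverPrimeLogPiLWField :
    ∀ (n : ℕ) (x : Fin n → ℂ),
      LinearIndependent ℚ ((Submodule.span ℚ
        ({z : ℂ | ∃ p : ℕ, p.Prime ∧ z = ((Real.log (p : ℝ) : ℝ) : ℂ)} ∪
          ({z : ℂ | IsAlgebraic ℚ z} ∪ {(Real.pi : ℂ) * Complex.I}))).mkQ ∘ x) →
      (n : Cardinal) ≤ Algebra.trdeg
        ↥(IntermediateField.adjoin ℚ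
            ({z : ℂ | ∃ p : ℕ, p.Prime ∧ z = ((Real.log (p : ℝ) : ℝ) : ℂ)} ∪
              ({z : ℂ | IsAlgebraic ℚ z} ∪ {(Real.pi : ℂ) * Complex.I} ∪
                Complex.exp '' {z : ℂ | IsAlgebraic ℚ z})))
        ↥(IntermediateField.adjoin
            ↥(IntermediateField.adjoin ℚ
              ({z : ℂ | ∃ p : ℕ, p.Prime ∧ z = ((Real.log (p : ℝ) : ℝ) : ℂ)} ∪
                ({z : ℂ | IsAlgebraic ℚ z} ∪ {(Real.pi : ℂ) * Complex.I} ∪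
                  Complex.exp '' {z : ℂ | IsAlgebraic ℚ z})))
            (Set.range x ∪ Set.range (Complex.exp ∘ x))) := by
  sorry

/-! ## Notation (purely syntactic abbreviations of the sets in the crux and the stubs) -/

set_option quotPrecheck false in
/-- The real logarithms of the primes, as complex numbers (verbatim the set in the crux). -/
local notation "Pℓ" => ({z : ℂ | ∃ p : ℕ, p.Prime ∧ z = ((Real.log (p : ℝ) : ℝ) : ℂ)} : Set ℂ)
set_option quotPrecheck false in
/-- The prime-log field `K₁ = ℚ(log p : p prime)`. -/
local notation "K₁" => (IntermediateField.adjoin ℚ Pℓ)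
set_option quotPrecheck false in
/-- The algebraic numbers. -/
local notation "𝔸" => ({z : ℂ | IsAlgebraic ℚ z} : Set ℂ)
/-- `πi`. -/
local notation "πI" => ((Real.pi : ℂ) * Complex.I)
set_option quotPrecheck false in
/-- The prime-log–π–LW field `L₁ = ℚ({log p} ∪ ℚ̄ ∪ {πi} ∪ e^{ℚ̄})`. -/
local notation "L₁" => (IntermediateField.adjoin ℚ (Pℓ ∪ (𝔸 ∪ {πI} ∪ Complex.exp '' 𝔸)))

/-! ## Bookkeeping lemmas -/

/-- Base change DOWN only increases the transcendence degree generated by a finite set, across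
different scalar fields: for subfields `F₁ ⊆ F₂` of `ℂ` (given as intermediate fields over
possibly different base fields) and finite `S`, `trdeg_{F₂} F₂(S) ≤ trdeg_{F₁} F₁(S)`.
(`SectorGlue.trdeg_adjoin_antitone_base` is the case of a common base `ℚ`.) [folklore] -/
theorem trdeg_adjoin_antitone_base' {K K' : Type} [Field K] [Field K'] [Algebra K ℂ]
    [Algebra K' ℂ] (F₁ : IntermediateField K ℂ) (F₂ : IntermediateField K' ℂ)
    (h12 : ∀ w : ℂ, w ∈ F₁ → w ∈ F₂) (S : Set ℂ) (hS : S.Finite) :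
    trdeg F₂ (adjoin F₂ S) ≤ trdeg F₁ (adjoin F₁ S) := by
  obtain ⟨t, ht⟩ := (AlgebraicIndependent.matroid F₂ ℂ).exists_isBasis S
  obtain ⟨hti, hts, hta⟩ := AlgebraicIndependent.matroid_isBasis_iff.1 ht
  have htf := hS.subset hts
  have hle : adjoin F₂ S ≤ (algebraicClosure (adjoin F₂ t) ℂ).restrictScalars F₂ :=
    adjoin_le_iff.2 fun w hw => mem_algebraicClosure_iff.2 (isAlgebraic_adjoin_iff.2 (hta w hw))
  let φ : F₁ →+* F₂ :=
    { toFun := fun w => ⟨(w : ℂ), h12 _ w.2⟩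
      map_one' := rfl
      map_mul' := fun _ _ => rfl
      map_zero' := rfl
      map_add' := fun _ _ => rfl }
  letI : Algebra F₁ F₂ := φ.toAlgebra
  haveI : IsScalarTower F₁ F₂ ℂ := .of_algebraMap_eq fun _ => rfl
  have hφ : Function.Injective (algebraMap F₁ F₂) := fun a b h =>
    Subtype.ext (congrArg Subtype.val h :)
  calc trdeg F₂ (adjoin F₂ S) ≤ htf.toFinset.card :=
        trdeg_le_card_of_forall_isAlgebraic (adjoin F₂ S).toSubalgebra htf.toFinset
          fun w hw => by
            rw [htf.coe_toFinset, ← isAlgebraic_adjoin_iff]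
            exact mem_algebraicClosure_iff.1 (hle hw)
    _ = Cardinal.mk t := by rw [← ncard_eq_toFinset_card t htf, cast_ncard htf]
    _ ≤ _ := (AlgebraicIndependent.of_comp (adjoin F₁ S).val
        (x := fun i : t => (⟨i, subset_adjoin F₁ S (hts i.2)⟩ : adjoin F₁ S))
        (hti.restrictScalars hφ)).cardinalMk_le_trdeg

/-- Exponentials of rational combinations of logarithms of primes are algebraic
(`e^{Σ cⱼ log pⱼ} = Π pⱼ^{cⱼ}`). [folklore] -/
theorem exp_mem_algebraicClosure_of_mem_span (v : ℂ) (hv : v ∈ span ℚ Pℓ) :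
    exp v ∈ algebraicClosure ℚ ℂ := by
  induction hv using Submodule.span_induction with
  | mem z hz =>
      obtain ⟨p, hp, rfl⟩ := hz
      rw [← Complex.ofReal_exp, Real.exp_log (by exact_mod_cast hp.pos)]
      exact_mod_cast _root_.natCast_mem (algebraicClosure ℚ ℂ) p
  | zero => rw [exp_zero]; exact one_mem _
  | add u w _ _ hu hw => rw [exp_add]; exact mul_mem hu hw
  | smul c u _ hu => rw [Rat.smul_def]; exact exp_rat_mul_mem_algebraicClosure ℚ u c hu

/-- Rational combinations of logarithms of primes lie in the prime-log field `K₁`. [folklore] -/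
theorem mem_primeLogField_of_mem_span (v : ℂ) (hv : v ∈ span ℚ Pℓ) : v ∈ K₁ :=
  (span_le (p := Subalgebra.toSubmodule (IntermediateField.adjoin ℚ Pℓ).toSubalgebra)).2
    (subset_adjoin ℚ _) hv

/-- Elements of the classical sector `E = span_ℚ({log p} ∪ ℚ̄ ∪ {πi})` and their exponentials
lie in the prime-log–π–LW field `L₁`. [folklore] -/
theorem mem_L_of_mem_E (w : ℂ) (hw : w ∈ span ℚ (Pℓ ∪ (𝔸 ∪ {πI}))) :
    w ∈ L₁ ∧ exp w ∈ L₁ := by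
  rw [span_union, mem_sup] at hw
  obtain ⟨v, hv, e, he, rfl⟩ := hw
  have hL₂ : IntermediateField.adjoin ℚ (𝔸 ∪ {πI} ∪ Complex.exp '' 𝔸) ≤ L₁ :=
    adjoin.mono ℚ _ _ subset_union_right
  have hvL : v ∈ L₁ :=
    (span_le (p := Subalgebra.toSubmodule
      (IntermediateField.adjoin ℚ (Pℓ ∪ (𝔸 ∪ {πI} ∪ Complex.exp '' 𝔸))).toSubalgebra)).2
      (fun s hs => subset_adjoin ℚ _ (.inl hs)) hv
  obtain ⟨heL, hexpL⟩ := mem_piLW_of_mem_span e he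
  refine ⟨add_mem hvL (hL₂ heL), ?_⟩
  rw [exp_add]
  exact mul_mem (subset_adjoin ℚ _ (.inr (.inl (.inl
    (mem_algebraicClosure_iff.1 (exp_mem_algebraicClosure_of_mem_span v hv)))))) (hL₂ hexpL)

/-- Freeness modulo a subspace `N` makes `span_ℚ(x)` disjoint from `N`. [folklore] -/
theorem disjoint_span_of_free {n : ℕ} {x : Fin n → ℂ} (N : Submodule ℚ ℂ)
    (hx : LinearIndependent ℚ (N.mkQ ∘ x)) : Disjoint (span ℚ (range x)) N := by
  rw [disjoint_def]
  intro u hu huN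
  obtain ⟨c, rfl⟩ := (mem_span_range_iff_exists_fun ℚ).1 hu
  have h0 : ∑ i, c i • (N.mkQ ∘ x) i = 0 := by
    have : N.mkQ (∑ i, c i • x i) = 0 := (Submodule.Quotient.mk_eq_zero N).2 huN
    simpa [map_sum, map_smul] using this
  have hc := Fintype.linearIndependent_iff.1 hx c h0
  simp [hc]

/-! ## The inside count over `K₁` -/

/-- **Inside count, algebraic–π part.** Stub 1 implies the `K₁`-relative Schanuel count
`k ≤ trdeg_{K₁} K₁(e, eᵉ)` for `ℚ`-free tuples `e` FROM `span_ℚ(ℚ̄ ∪ {πi})`: write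
`eᵢ = bᵢ + qᵢ πi`; if all `qᵢ = 0` apply the stub to `e` and drop `π`; otherwise apply it to the
`k − 1` algebraic numbers `q_j e_s − q_s e_j` (`q_j ≠ 0`), over whose exponentials together with
`π` the field `K₁(e, eᵉ)` is co-algebraic (the proof of `SectorGlue.inside_count`, base `K₁`).
[folklore] -/
theorem inside_count_alg
    (hP : ∀ (d : ℕ) (a : Fin d → ℂ), (∀ i, IsAlgebraic ℚ (a i)) → LinearIndependent ℚ a →
      ((d + 1 : ℕ) : Cardinal) ≤ Algebra.trdeg
        ↥(IntermediateField.adjoin ℚ {z : ℂ | ∃ p : ℕ, p.Prime ∧ z = ((Real.log (p : ℝ) : ℝ) : ℂ)})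
        ↥(IntermediateField.adjoin
            ↥(IntermediateField.adjoin ℚ {z : ℂ | ∃ p : ℕ, p.Prime ∧ z = ((Real.log (p : ℝ) : ℝ) : ℂ)})
            (insert (Real.pi : ℂ) (Set.range (Complex.exp ∘ a)))))
    (k : ℕ) (e : Fin k → ℂ) (he : ∀ i, e i ∈ span ℚ (𝔸 ∪ {πI}))
    (hli : LinearIndependent ℚ e) :
    (k : Cardinal) ≤ trdeg K₁ (adjoin K₁ (range e ∪ range (exp ∘ e))) := by
  have hAC : ∀ {R : Type} [Field R] [Algebra R ℂ] {w : ℂ},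
      w ∈ algebraicClosure R ℂ ↔ IsAlgebraic R w := mem_algebraicClosure_iff
  choose b hb q hyq using fun i => exists_eq_add_rat_mul_pi_I_of_mem_span _ (he i)
  set F := adjoin K₁ (range e ∪ range (exp ∘ e))
  have algF : ∀ {w : ℂ}, IsAlgebraic ℚ w → IsAlgebraic F w := fun hw =>
    (hw.tower_top (L := K₁)).tower_top (L := F)
  by_cases hq : ∀ i, q i = 0
  · have h1 := hP k e (fun i => hAC.1 (by
      rw [hyq i, hq i, Rat.cast_zero, zero_mul, add_zero]; exact hb i)) hli
    rw [Nat.cast_succ] at h1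
    exact Cardinal.add_one_le_add_one_iff.1 (h1.trans ((trdeg_adjoin_insert_le K₁ _ _).trans
      (add_le_add (trdeg_mono (adjoin.mono K₁ _ _ subset_union_right)) le_rfl)))
  obtain ⟨j, hj⟩ := not_forall.1 hq
  obtain ⟨k, rfl⟩ : ∃ k', k = k' + 1 := ⟨k - 1, by have := j.pos; omega⟩
  have aF : ∀ {w : ℂ}, w ∈ F → IsAlgebraic F w := fun hw => isAlgebraic_algebraMap (⟨_, hw⟩ : F)
  have yF : ∀ i, e i ∈ F := fun i => subset_adjoin K₁ _ (.inl ⟨i, rfl⟩)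
  have eF : ∀ i, exp (e i) ∈ algebraicClosure F ℂ := fun i =>
    hAC.2 (aF (subset_adjoin K₁ _ (.inr ⟨i, rfl⟩)))
  set a : Fin k → ℂ := fun s => q j • e (j.succAbove s) - q (j.succAbove s) • e j with ha
  have hal : ∀ s, IsAlgebraic ℚ (a s) := fun s => hAC.1 (by
    have : a s = (q j : ℂ) * b (j.succAbove s) - (q (j.succAbove s) : ℂ) * b j := by
      simp only [ha, Rat.smul_def]
      rw [hyq (j.succAbove s), hyq j, mul_add, mul_add, mul_left_comm ((q j : ℚ) : ℂ),
        add_sub_add_right_eq_sub]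
    rw [this]
    exact sub_mem (mul_mem (SubfieldClass.ratCast_mem _ _) (hb _))
      (mul_mem (SubfieldClass.ratCast_mem _ _) (hb _)))
  have hli' : LinearIndependent ℚ a := by
    rw [Fintype.linearIndependent_iff]
    intro g hg s
    have h0 := Fintype.linearIndependent_iff.mp hli
      (Fin.insertNth j (-∑ s, g s * q (j.succAbove s)) fun s => g s * q j) (by
        rw [Fin.sum_univ_succAbove _ j, Fin.insertNth_apply_same, ← hg]
        simp only [Fin.insertNth_apply_succAbove, ha, smul_sub, mul_smul, neg_smul,
          Finset.sum_smul, Finset.sum_sub_distrib]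
        abel) (j.succAbove s)
    rw [Fin.insertNth_apply_succAbove] at h0
    exact (mul_eq_zero.mp h0).resolve_right hj
  have hpi : IsAlgebraic F (Real.pi : ℂ) := by
    have hqj : ((q j : ℚ) : ℂ) ≠ 0 := by exact_mod_cast hj
    have h1 : (Real.pi : ℂ) * I = (e j - b j) * (((q j)⁻¹ : ℚ) : ℂ) := by
      rw [Rat.cast_inv, hyq j, add_sub_cancel_left, mul_comm ((q j : ℚ) : ℂ),
        mul_inv_cancel_right₀ hqj]
    have h2 : (Real.pi : ℂ) = -(Real.pi * I * I) := by
      rw [mul_assoc, I_mul_I, mul_neg_one, neg_neg]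
    rw [h2, h1]
    exact ((((aF (yF j)).sub (algF (hAC.1 (hb j)))).mul
      (aF (SubfieldClass.ratCast_mem F _))).mul
      (.of_pow two_pos (by rw [I_sq]; exact isAlgebraic_one.neg))).neg
  refine (hP k a hal hli').trans (trdeg_adjoin_le_of_subset_algebraicClosure K₁ F _ ?_)
  rintro w (rfl | ⟨s, rfl⟩)
  · exact hAC.2 hpi
  · simp only [Function.comp_apply, ha, Rat.smul_def, exp_sub]
    exact div_mem (exp_rat_mul_mem_algebraicClosure F _ _ (eF _))
      (exp_rat_mul_mem_algebraicClosure F _ _ (eF _))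

/-- **Inside count on the classical sector.** Stub 1 implies the `K₁`-relative Schanuel count
`k ≤ trdeg_{K₁} K₁(y, eʸ)` for tuples `y` FROM `E = span_ℚ({log p} ∪ ℚ̄ ∪ {πi})` that are free
modulo `V₁ = span_ℚ{log p}`: write `yᵢ = vᵢ + eᵢ` with `vᵢ ∈ V₁ ⊆ K₁` and
`eᵢ ∈ span_ℚ(ℚ̄ ∪ {πi})`; `e` is `ℚ`-free, `K₁(e, eᵉ) ⊆ K₁(y, eʸ)^{alg}` (`e^{vᵢ}` is algebraic),
and `inside_count_alg` applies to `e`. [folklore] -/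
theorem inside_count
    (hP : ∀ (d : ℕ) (a : Fin d → ℂ), (∀ i, IsAlgebraic ℚ (a i)) → LinearIndependent ℚ a →
      ((d + 1 : ℕ) : Cardinal) ≤ Algebra.trdeg
        ↥(IntermediateField.adjoin ℚ {z : ℂ | ∃ p : ℕ, p.Prime ∧ z = ((Real.log (p : ℝ) : ℝ) : ℂ)})
        ↥(IntermediateField.adjoin
            ↥(IntermediateField.adjoin ℚ {z : ℂ | ∃ p : ℕ, p.Prime ∧ z = ((Real.log (p : ℝ) : ℝ) : ℂ)})
            (insert (Real.pi : ℂ) (Set.range (Complex.exp ∘ a)))))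
    (k : ℕ) (y : Fin k → ℂ) (hy : ∀ i, y i ∈ span ℚ (Pℓ ∪ (𝔸 ∪ {πI})))
    (hfree : LinearIndependent ℚ ((span ℚ Pℓ).mkQ ∘ y)) :
    (k : Cardinal) ≤ trdeg K₁ (adjoin K₁ (range y ∪ range (exp ∘ y))) := by
  have hAC : ∀ {R : Type} [Field R] [Algebra R ℂ] {w : ℂ},
      w ∈ algebraicClosure R ℂ ↔ IsAlgebraic R w := mem_algebraicClosure_iff
  have hdec : ∀ i, ∃ v ∈ span ℚ Pℓ, ∃ e ∈ span ℚ (𝔸 ∪ {πI}), y i = v + e := fun i => by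
    have h := hy i
    rw [span_union, mem_sup] at h
    obtain ⟨v, hv, e, he, h⟩ := h
    exact ⟨v, hv, e, he, h.symm⟩
  choose v hv e he hye using hdec
  have heli : LinearIndependent ℚ e := by
    rw [Fintype.linearIndependent_iff]
    intro g hg
    have h1 : ∑ i, g i • y i = ∑ i, g i • v i := by
      have : ∑ i, g i • y i = ∑ i, g i • v i + ∑ i, g i • e i := by
        rw [← Finset.sum_add_distrib]
        exact Finset.sum_congr rfl fun i _ => by rw [hye i, smul_add]
      rw [this, hg, add_zero]
    have h2 : (span ℚ Pℓ).mkQ (∑ i, g i • y i) = 0 := by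
      rw [h1]
      exact (Submodule.Quotient.mk_eq_zero _).2 (sum_mem fun i _ => smul_mem _ _ (hv i))
    have h0 : ∑ i, g i • ((span ℚ Pℓ).mkQ ∘ y) i = 0 := by
      simpa [map_sum, map_smul] using h2
    exact Fintype.linearIndependent_iff.1 hfree g h0
  set F := adjoin K₁ (range y ∪ range (exp ∘ y))
  have algF : ∀ {w : ℂ}, IsAlgebraic ℚ w → IsAlgebraic F w := fun hw =>
    (hw.tower_top (L := K₁)).tower_top (L := F)
  have hvF : ∀ i, v i ∈ F := fun i =>
    F.algebraMap_mem ⟨v i, mem_primeLogField_of_mem_span _ (hv i)⟩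
  refine (inside_count_alg hP k e he heli).trans
    (trdeg_adjoin_le_of_subset_algebraicClosure K₁ F _ ?_)
  rintro w (⟨i, rfl⟩ | ⟨i, rfl⟩)
  · have h : e i = y i - v i := by rw [hye i]; ring
    rw [h]
    exact hAC.2 (isAlgebraic_algebraMap
      (⟨_, sub_mem (subset_adjoin K₁ _ (.inl ⟨i, rfl⟩)) (hvF i)⟩ : F))
  · have h : exp (e i) = exp (y i) * exp (-(v i)) := by
      rw [← exp_add, hye i]; ring_nf
    simp only [Function.comp_apply]
    rw [h]
    exact mul_mem (hAC.2 (isAlgebraic_algebraMap (⟨_, subset_adjoin K₁ _ (.inr ⟨i, rfl⟩)⟩ : F)))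
      (hAC.2 (algF (hAC.1 (exp_mem_algebraicClosure_of_mem_span _ (neg_mem (hv i))))))

/-! ## The engine over `K₁` and the composition -/

/-- **The composition, crux statement UNFOLDED** (PROVED, no sorry): the two stub statements,
verbatim, imply the statement of `OffPrimeLogSector` — Kirby's `GL_n(ℚ)` sector reduction along
`E = span_ℚ({log p} ∪ ℚ̄ ∪ {πi})` over `L₁`, bottom field `K₁`.  (Stated with the crux unfolded so
that `OffPrimeLogSector_of` below is the only theorem concluding the crux by name, from exactly the
two registered stubs.) -/
theorem offPrimeLogSector_of_pieces
    (hA : ∀ (d : ℕ) (a : Fin d → ℂ), (∀ i, IsAlgebraic ℚ (a i)) → LinearIndependent ℚ a →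
      ((d + 1 : ℕ) : Cardinal) ≤ Algebra.trdeg
        ↥(IntermediateField.adjoin ℚ {z : ℂ | ∃ p : ℕ, p.Prime ∧ z = ((Real.log (p : ℝ) : ℝ) : ℂ)})
        ↥(IntermediateField.adjoin
            ↥(IntermediateField.adjoin ℚ {z : ℂ | ∃ p : ℕ, p.Prime ∧ z = ((Real.log (p : ℝ) : ℝ) : ℂ)})
            (insert (Real.pi : ℂ) (Set.range (Complex.exp ∘ a)))))
    (hB : ∀ (n : ℕ) (x : Fin n → ℂ),
      LinearIndependent ℚ ((Submodule.span ℚ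
        ({z : ℂ | ∃ p : ℕ, p.Prime ∧ z = ((Real.log (p : ℝ) : ℝ) : ℂ)} ∪
          ({z : ℂ | IsAlgebraic ℚ z} ∪ {(Real.pi : ℂ) * Complex.I}))).mkQ ∘ x) →
      (n : Cardinal) ≤ Algebra.trdeg
        ↥(IntermediateField.adjoin ℚ
            ({z : ℂ | ∃ p : ℕ, p.Prime ∧ z = ((Real.log (p : ℝ) : ℝ) : ℂ)} ∪
              ({z : ℂ | IsAlgebraic ℚ z} ∪ {(Real.pi : ℂ) * Complex.I} ∪
                Complex.exp '' {z : ℂ | IsAlgebraic ℚ z})))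
        ↥(IntermediateField.adjoin
            ↥(IntermediateField.adjoin ℚ
              ({z : ℂ | ∃ p : ℕ, p.Prime ∧ z = ((Real.log (p : ℝ) : ℝ) : ℂ)} ∪
                ({z : ℂ | IsAlgebraic ℚ z} ∪ {(Real.pi : ℂ) * Complex.I} ∪
                  Complex.exp '' {z : ℂ | IsAlgebraic ℚ z})))
            (Set.range x ∪ Set.range (Complex.exp ∘ x)))) :
    ∀ (n : ℕ) (x : Fin n → ℂ),
      LinearIndependent ℚ ((Submodule.span ℚ
        {z : ℂ | ∃ p : ℕ, p.Prime ∧ z = ((Real.log (p : ℝ) : ℝ) : ℂ)}).mkQ ∘ x) →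
      (n : Cardinal) ≤ Algebra.trdeg
        ↥(IntermediateField.adjoin ℚ {z : ℂ | ∃ p : ℕ, p.Prime ∧ z = ((Real.log (p : ℝ) : ℝ) : ℂ)})
        ↥(IntermediateField.adjoin
            ↥(IntermediateField.adjoin ℚ {z : ℂ | ∃ p : ℕ, p.Prime ∧ z = ((Real.log (p : ℝ) : ℝ) : ℂ)})
            (Set.range x ∪ Set.range (Complex.exp ∘ x))) := by
  intro n x hx
  have hAC : ∀ {R : Type} [Field R] [Algebra R ℂ] {w : ℂ},
      w ∈ algebraicClosure R ℂ ↔ IsAlgebraic R w := mem_algebraicClosure_iff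
  have hxli : LinearIndependent ℚ x := LinearIndependent.of_comp _ hx
  set E : Submodule ℚ ℂ := span ℚ (Pℓ ∪ (𝔸 ∪ {πI})) with hE
  set V : Submodule ℚ ℂ := span ℚ (range x) with hV
  haveI : FiniteDimensional ℚ V := FiniteDimensional.span_of_finite ℚ (finite_range x)
  obtain ⟨U', hU'⟩ := (V ⊓ E).exists_isCompl
  set W : Submodule ℚ ℂ := V ⊓ E
  set U : Submodule ℚ ℂ := V ⊓ U' with hU
  haveI : FiniteDimensional ℚ W := finiteDimensional_of_le inf_le_left
  haveI : FiniteDimensional ℚ U := finiteDimensional_of_le inf_le_left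
  have hsup : W ⊔ U = V := by
    rw [hU, inf_comm, ← sup_inf_assoc_of_le U' (inf_le_left : W ≤ V), hU'.sup_eq_top, top_inf_eq]
  have hdj : Disjoint W U := hU'.disjoint.mono_right inf_le_right
  set k := Module.finrank ℚ W
  set m := Module.finrank ℚ U
  have hn : k + m = n := by
    have h1 := finrank_sup_add_finrank_inf_eq W U
    rw [hdj.eq_bot, finrank_bot, add_zero, hsup, hV, finrank_span_eq_card hxli,
      Fintype.card_fin] at h1
    exact h1.symm
  let bW := Module.finBasis ℚ W
  let bU := Module.finBasis ℚ U
  let y : Fin k → ℂ := fun i => bW i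
  let z : Fin m → ℂ := fun j => bU j
  have hyli : LinearIndependent ℚ y := bW.linearIndependent.map' W.subtype W.ker_subtype
  have hzli : LinearIndependent ℚ z := bU.linearIndependent.map' U.subtype U.ker_subtype
  have hyE : ∀ i, y i ∈ E := fun i => (bW i).2.2
  have hyfree : LinearIndependent ℚ ((span ℚ Pℓ).mkQ ∘ y) := by
    refine hyli.map ?_
    rw [ker_mkQ]
    exact (disjoint_span_of_free _ hx).mono_left
      (span_le.2 (range_subset_iff.2 fun i => (bW i).2.1))
  have hzE : LinearIndependent ℚ (E.mkQ ∘ z) := by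
    refine hzli.map ?_
    rw [ker_mkQ, disjoint_def]
    intro u hu huE
    have huU : u ∈ U := span_le.2 (range_subset_iff.2 fun j => (bU j).2) hu
    exact disjoint_def.1 hdj u ⟨huU.1, huE⟩ huU
  set Sy := range y ∪ range (exp ∘ y)
  set Sz := range z ∪ range (exp ∘ z)
  set Ky := adjoin K₁ Sy
  set Kx := adjoin K₁ (range x ∪ range (exp ∘ x))
  have hK₁L : K₁ ≤ L₁ := adjoin.mono ℚ _ _ subset_union_left
  have hKyL : ∀ w : ℂ, w ∈ Ky → w ∈ L₁ := by
    intro w hw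
    have hle : Ky ≤ IntermediateField.extendScalars hK₁L := adjoin_le_iff.2 (by
      rintro _ (⟨i, rfl⟩ | ⟨i, rfl⟩)
      · exact (mem_L_of_mem_E _ (hyE i)).1
      · exact (mem_L_of_mem_E _ (hyE i)).2)
    exact (IntermediateField.mem_extendScalars hK₁L).1 (hle hw)
  have hVK : ∀ a ∈ V, a ∈ Kx ∧ exp a ∈ algebraicClosure Kx ℂ := by
    intro a ha
    obtain ⟨c, rfl⟩ := (mem_span_range_iff_exists_fun ℚ).1 ha
    refine ⟨sum_mem fun i _ => ?_, ?_⟩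
    · rw [Rat.smul_def]
      exact mul_mem (SubfieldClass.ratCast_mem Kx _) (subset_adjoin K₁ _ (.inl ⟨i, rfl⟩))
    · simp_rw [Rat.smul_def]
      rw [exp_sum]
      exact prod_mem fun i _ => exp_rat_mul_mem_algebraicClosure Kx _ _
        (hAC.2 (isAlgebraic_algebraMap (⟨_, subset_adjoin K₁ _ (.inr ⟨i, rfl⟩)⟩ : Kx)))
  refine (show (n : Cardinal) = k + m by rw [← hn, Nat.cast_add]).trans_le ((add_le_add
    (inside_count hA k y hyE hyfree) ((hB m z hzE).trans
    (trdeg_adjoin_antitone_base' Ky L₁ hKyL Sz ((finite_range z).union (finite_range _))))).trans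
    ((trdeg_add_trdeg_adjoin_le K₁ Sy Sz).trans
    (trdeg_adjoin_le_of_subset_algebraicClosure K₁ Kx _ ?_)))
  rintro w ((⟨i, rfl⟩ | ⟨i, rfl⟩) | (⟨j, rfl⟩ | ⟨j, rfl⟩))
  · exact hAC.2 (isAlgebraic_algebraMap (⟨_, (hVK _ (bW i).2.1).1⟩ : Kx))
  · exact (hVK _ (bW i).2.1).2
  · exact hAC.2 (isAlgebraic_algebraMap (⟨_, (hVK _ (bU j).2.1).1⟩ : Kx))
  · exact (hVK _ (bU j).2.1).2

/-- **The skeleton theorem: the crux BY NAME from exactly the two registered stubs.**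
`OffPrimeLogSector` (item stmt-Schanuel-7090 of routes AdelicLogSector / BenfordTowers) follows from
`stub_piLWFreeOverPrimeLogField` and `stub_relSchanuelOverPrimeLogPiLWField` by the proved
composition `offPrimeLogSector_of_pieces`; the only sorries in its cone are the two stubs. -/
theorem OffPrimeLogSector_of : OffPrimeLogSector :=
  offPrimeLogSector_of_pieces stub_piLWFreeOverPrimeLogField stub_relSchanuelOverPrimeLogPiLWField

end Summit.Schanuel.Schanuel.Cruxes.OffPrimeLogSector.Birth
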